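import Mathlib.Analysis.Calculus.ContDiff.Basic
import Mathlib.Analysis.Calculus.ContDiff.Comp
import Mathlib.Analysis.Calculus.IteratedDeriv.Lemmas
import Mathlib.Analysis.Calculus.TangentCone.Prod
import Literature.Analysis.Calculus.IteratedFDerivSymmetric
import HarnessLib

/-!
# Mixed partial derivatives within a product set as entries of the joint iterated derivative

Topic `Literature/Analysis/Calculus` (everything proved; no definitions, no named facts).  The classical
dictionary between ITERATED PARTIAL derivatives and the HIGHER TOTAL derivative
(Coleman, *Calculus on Normed Vector Spaces*, §4.5 "Higher differentials and higher derivatives":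
`∂^k f/∂x_{i₁}⋯∂x_{i_k}(a) = f^{(k)}(a)(e_{i₁}, …, e_{i_k})`, differentiating first in `x_{i_k}`, last in
`x_{i₁}` — the convention of Mathlib's `iteratedFDeriv`, whose FIRST slot is the outermost derivative), in
the form needed for one-sided expansion parameters: derivatives WITHIN a product set `univ ×ˢ I` (`I` a set
of unique differentiability, e.g. a closed interval), where Mathlib's `iteratedFDerivWithin` replaces `f^{(k)}`.

* §1 **`iteratedFDerivWithin_append_apply`** — `D^{α+β}_s f(x)(v, w) = D^α_s(D^β_s f)(x)(v)(w)` for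
  `v : Fin α → E`, `w : Fin β → E` (`Fin.append v w`; unconditional in `f`, given unique differentiability
  on `s` and `x ∈ s`); `iteratedFDeriv_append_apply` (whole space); `iteratedFDerivWithin_apply_eq_append`
  (`D^α_s[y ↦ D^β_s f(y)(w)](x)(v) = D^{α+β}_s f(x)(v, w)` for `f ∈ C^{α+β}(s)`).
* §2 (private `uniqueDiffOn_vadd_set`), **`iteratedFDerivWithin_comp_affine`** — chain rule for an affine
  substitution `y ↦ a + Ly` within sets: `D^i_{A⁻¹S}(f ∘ A)(y) = D^i_S f(Ay) ∘ (L, …, L)`.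
* §3 slices of `Φ : F₁ × F₂ → G` of class `C^n` within `univ ×ˢ I`: `iteratedFDerivWithin_slice_snd`
  (`D^i_I[Φ(e, ·)](t) = D^i Φ(e,t) ∘ (inr, …)`), `iteratedDerivWithin_slice_snd_apply` (scalar second factor:
  `= D^iΦ(e,t)((0,1), …, (0,1))`), `iteratedFDeriv_slice_fst`, `iteratedDeriv_slice_fst_apply`
  (`= D^iΦ(e,t)((1,0), …, (1,0))`), private `contDiffOn_iteratedFDerivWithin_apply_const`.
* §4 MIXED PARTIALS of `Φ : 𝕜 × 𝕜 → G` within `univ ×ˢ I` at `(e₀, t)`, `t ∈ I`, `α + β ≤ n`: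
  **`iteratedDeriv_iteratedDerivWithin_slice_eq_append`**
  (`∂^α_e[∂^β_{s,I}Φ(e, ·)(t)](e₀) = D^{α+β}Φ(e₀,t)((1,0)^α, (0,1)^β)`) and
  **`iteratedDerivWithin_iteratedDeriv_slice_eq_append`** (the other order, `((0,1)^β, (1,0)^α)`).
* §5 SYMMETRY WITHIN: `iteratedFDerivWithin_comp_perm_of_mem_closure_interior` (over `ℝ` or `ℂ`, at points
  of `s ∩ closure (interior s)` the within-derivative `D^m_s f(x)` is symmetric — Schwarz's theorem
  (Coleman §4.4 Cor. 4.3 / §4.1 Thm. 4.3) passed to the limit from interior points), private re-indexing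
  helpers `iteratedFDerivWithin_cast_apply`, `append_comp_finAddFlip`, and **`iteratedDeriv_iteratedDerivWithin_comm`**:
  `∂^α_e ∂^β_{s,I} Φ = ∂^β_{s,I} ∂^α_e Φ` at `(e₀, t)` for `t ∈ I ∩ closure (interior I)`.
* §6 (v1.1) the same dictionary for a PRODUCT SET `I ×ˢ Λ` with BOTH factors of unique differentiability
  (fully-within forms, suffix `_prod`: `iteratedFDerivWithin_slice_snd_prod` / `…_slice_fst_prod`,
  `iteratedDerivWithin_slice_snd_apply_prod` / `…_slice_fst_apply_prod`,
  `contDiffOn_iteratedDerivWithin_slice_snd_prod` / `…_slice_fst_prod`,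
  **`iteratedDerivWithin_iteratedDerivWithin_slice_snd_eq_append_prod`** / `…_slice_fst_eq_append_prod`,
  **`iteratedDerivWithin_iteratedDerivWithin_comm_prod`** at `(e₀, t)` with `e₀ ∈ I ∩ closure (interior I)`,
  `t ∈ Λ ∩ closure (interior Λ)`) and, for an OPEN first factor `I`, with the unconstrained derivative
  `iteratedDeriv` in the free variable (suffix `_openFst`: `iteratedDeriv_slice_fst_apply_openFst`,
  **`iteratedDeriv_iteratedDerivWithin_slice_eq_append_openFst`**, `iteratedDerivWithin_iteratedDeriv_slice_eq_append_openFst`,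
  `contDiffOn_iteratedDerivWithin_slice_openFst`, **`iteratedDeriv_iteratedDerivWithin_comm_openFst`**) — the
  slab `I ×ˢ [0, δ)` of a function smooth for `e` in an open interval and one-sided in `λ`; §3–§5 are the case
  `I = univ`.

Universe note: §1 and §4 are proved by induction on `β` through the curried derivative
`D^{β+1} = curryRight⁻¹ ∘ D^β ∘ D`, whose codomain changes; domain and codomain are therefore taken in ONE
universe (all uses in the tree are in `Type`).

## Mathlib / tree search

Mathlib: `iteratedFDerivWithin_succ_apply_right`, `iteratedFDerivWithin_succ_eq_comp_right`,
`ContinuousLinearMap.iteratedFDerivWithin_comp_right/left`, `iteratedFDerivWithin_comp_add_left`,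
`ContDiffWithinAt.iteratedFDerivWithin_right`, `ContDiffAt.isSymmSndFDerivAt` (order two); nothing splitting
`D^{α+β}` into `D^α D^β` on tuples, no within-slices, no all-orders within-symmetry (searched
`iteratedFDerivWithin.*append`, `iteratedDeriv.*iteratedFDerivWithin`, `comp_perm`).  Tree (open sets / norm
inequalities only): `MixedPartialBound` (`‖D^i_ξ ∂^j_θ g‖ ≤ ‖D^{i+j} g‖`), `SliceDerivatives`,
`SpaceTimeSliceDerivatives`, `LineRestrictionIteratedDeriv`, `MixedPartials` (order two),
`IteratedFDerivSymmetric` (symmetry at points of `ContDiffAt`, used in §5).  Consumer: the (e′, λ′)-expansion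
(1.5) of Bałaban's `(Higgs)₂,₃` III on `ℝ × [0, δ]` (`Balaban1983to89/B3Eq15JointSmooth`, `…/B3Eq15MixedPartials`);
filed by the lit-balaban typer (statement-level skeleton of published theorems with citation tags; proofs where
landed; nothing here is a claim about the Yang–Mills mass gap).  v1.1 (§6, APPEND-ONLY; §1–§5 byte-identical):
the product-set / open-first-factor forms, generalising the file-local copies of `Balaban1983to89/B3Eq119JointSmooth`
§6 (the `(e, λ)`-expansion (1.19)–(1.23) of `(Higgs)₂,₃` III on a slab `I ×ˢ [0, δ)`, `I` an open interval of
charges); filed by lit-balaban p39 at the typer's request.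

## References

* R. Coleman, *Calculus on Normed Vector Spaces*, Universitext, Springer 2012, Ch. 4 (pp. 79ff.): §4.1
  Thm. 4.3 (equality of mixed partials of `C^k` functions under permutations), §4.4 Cor. 4.3 (`f^{(k)}(a)` is
  symmetric), §4.5 (display `∂^k f/∂x_{i₁}⋯∂x_{i_k}(a) = f^{(k)}(a)(e_{i₁}, …, e_{i_k})`). [Coleman2012]
  (Held: `book:coleman2012-calculus-normed-vector-spaces`; section/theorem numbers read from the text layer.)
* J. Dieudonné, *Foundations of Modern Analysis* (1960), (8.12.4). [Dieudonne1960]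
-/

noncomputable section

open Set Function Filter
open scoped Topology ContDiff Pointwise

namespace Literature.Analysis.Calculus

universe u

variable {𝕜 : Type*} [NontriviallyNormedField 𝕜]

/-! ## §1 `D^{α+β} = D^α ∘ D^β` on tuples `(v, w)` -/

section Append

variable {E F : Type u} [NormedAddCommGroup E] [NormedSpace 𝕜 E] [NormedAddCommGroup F] [NormedSpace 𝕜 F]

/-- **`D^{α+β}_s f(x)(v, w) = D^α_s (D^β_s f)(x)(v)(w)`**: the `(α+β)`-th derivative within `s` on the
concatenated tuple `Fin.append v w` is the `α`-th derivative within `s` of the (`β`-multilinear-map valued)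
`β`-th derivative, evaluated first on `v` then on `w` — the outer derivatives occupy the first slots
(Mathlib's convention; Coleman §4.5).  Unconditional in `f` (unique differentiability on `s`,
`x ∈ s`); `E`, `F` in one universe. [cite: Coleman2012, §4.5] -/
theorem iteratedFDerivWithin_append_apply {s : Set E} (hs : UniqueDiffOn 𝕜 s) {x : E} (hx : x ∈ s)
    (α β : ℕ) :
    ∀ {F : Type u} [NormedAddCommGroup F] [NormedSpace 𝕜 F] (f : E → F) (v : Fin α → E) (w : Fin β → E),
      iteratedFDerivWithin 𝕜 (α + β) f s x (Fin.append v w)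
        = iteratedFDerivWithin 𝕜 α (iteratedFDerivWithin 𝕜 β f s) s x v w := by
  induction β generalizing x with
  | zero =>
    intro F _ _ f v w
    have hw : w = Fin.elim0 := Subsingleton.elim _ _
    subst hw
    have h0 : iteratedFDerivWithin 𝕜 α (iteratedFDerivWithin 𝕜 0 f s) s x
        = ContinuousLinearMap.compContinuousMultilinearMap
            ((continuousMultilinearCurryFin0 𝕜 E F).symm.toContinuousLinearEquiv : F →L[𝕜] (E [×0]→L[𝕜] F))
            (iteratedFDerivWithin 𝕜 α f s x) := by
      rw [iteratedFDerivWithin_zero_eq_comp]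
      exact (continuousMultilinearCurryFin0 𝕜 E F).symm.toContinuousLinearEquiv.iteratedFDerivWithin_comp_left
        f hs hx α
    rw [h0, Fin.append_elim0, ContinuousLinearMap.compContinuousMultilinearMap_coe, Function.comp_apply]
    rfl
  | succ β ih =>
    intro F _ _ f v w
    have hw : Fin.append v w = Fin.snoc (Fin.append v (Fin.init w)) (w (Fin.last β)) := by
      rw [← Fin.append_snoc, Fin.snoc_init_self]
    have key := @ih x hx (E →L[𝕜] F) _ _ (fun y => fderivWithin 𝕜 f s y) v (Fin.init w)
    -- the right-hand side, unfolded once (`D^{β+1} = curryRight⁻¹ ∘ D^β ∘ D` on `s`)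
    set G := iteratedFDerivWithin 𝕜 β (fun y => fderivWithin 𝕜 f s y) s with hG
    set g : (E [×β]→L[𝕜] E →L[𝕜] F) ≃L[𝕜] (E [×(β + 1)]→L[𝕜] F) :=
      (continuousMultilinearCurryRightEquiv' 𝕜 β E F).symm.toContinuousLinearEquiv with hg
    have hcongr : iteratedFDerivWithin 𝕜 α (iteratedFDerivWithin 𝕜 (β + 1) f s) s x
        = iteratedFDerivWithin 𝕜 α (g ∘ G) s x := by
      refine iteratedFDerivWithin_congr (fun y hy => ?_) hx α
      rw [iteratedFDerivWithin_succ_eq_comp_right hs hy]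
      rfl
    have hL : iteratedFDerivWithin 𝕜 α (g ∘ G) s x
        = (g : _ →L[𝕜] _).compContinuousMultilinearMap (iteratedFDerivWithin 𝕜 α G s x) :=
      g.iteratedFDerivWithin_comp_left G hs hx α
    have rhs : iteratedFDerivWithin 𝕜 α (iteratedFDerivWithin 𝕜 (β + 1) f s) s x v w
        = iteratedFDerivWithin 𝕜 α G s x v (Fin.init w) (w (Fin.last β)) := by
      conv_lhs => rw [hcongr, hL, ContinuousLinearMap.compContinuousMultilinearMap_coe, Function.comp_apply]
      rfl
    rw [hw, rhs]
    have step := iteratedFDerivWithin_succ_apply_right hs hx (f := f)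
      (Fin.snoc (Fin.append v (Fin.init w)) (w (Fin.last β)))
    rw [Fin.init_snoc, Fin.snoc_last] at step
    exact step.trans (congrArg (fun T : E →L[𝕜] F => T (w (Fin.last β))) key)

/-- **`D^{α+β} f(x)(v, w) = D^α(D^β f)(x)(v)(w)`** on the whole space (`E`, `F` in one universe).
[cite: Coleman2012, §4.5] -/
theorem iteratedFDeriv_append_apply (f : E → F) (x : E) {α β : ℕ} (v : Fin α → E) (w : Fin β → E) :
    iteratedFDeriv 𝕜 (α + β) f x (Fin.append v w) = iteratedFDeriv 𝕜 α (iteratedFDeriv 𝕜 β f) x v w := by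
  simp only [← iteratedFDerivWithin_univ]
  exact iteratedFDerivWithin_append_apply uniqueDiffOn_univ (mem_univ x) α β f v w

/-- **`D^α_s[y ↦ D^β_s f(y)(w)](x)(v) = D^{α+β}_s f(x)(v, w)`** for `f` of class `C^n` within `s`,
`α + β ≤ n`: differentiating `α` more times the `β`-th derivative EVALUATED on a fixed tuple `w` gives
the joint derivative on `(v, w)` (evaluation is a continuous linear map, so it commutes with `D^α_s`).
[cite: Coleman2012, §4.5] -/
theorem iteratedFDerivWithin_apply_eq_append {s : Set E} (hs : UniqueDiffOn 𝕜 s) {x : E} (hx : x ∈ s)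
    {n : WithTop ℕ∞} {f : E → F} (hf : ContDiffOn 𝕜 n f s) {α β : ℕ}
    (hαβ : ((α + β : ℕ) : WithTop ℕ∞) ≤ n) (v : Fin α → E) (w : Fin β → E) :
    iteratedFDerivWithin 𝕜 α (fun y => iteratedFDerivWithin 𝕜 β f s y w) s x v
      = iteratedFDerivWithin 𝕜 (α + β) f s x (Fin.append v w) := by
  rw [iteratedFDerivWithin_append_apply hs hx]
  have hβ : ContDiffWithinAt 𝕜 α (iteratedFDerivWithin 𝕜 β f s) s x :=
    (hf x hx).iteratedFDerivWithin_right hs (by exact_mod_cast hαβ) hx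
  have e : (fun y => iteratedFDerivWithin 𝕜 β f s y w)
      = (ContinuousMultilinearMap.apply 𝕜 (fun _ : Fin β => E) F w) ∘ iteratedFDerivWithin 𝕜 β f s := by
    funext y; simp
  rw [e, ContinuousLinearMap.iteratedFDerivWithin_comp_left _ hβ hs hx le_rfl,
    ContinuousLinearMap.compContinuousMultilinearMap_coe, Function.comp_apply, ContinuousMultilinearMap.apply_apply]

end Append

/-! ## §2 Affine substitutions within sets -/

section Affine

variable {E F G : Type*} [NormedAddCommGroup E] [NormedSpace 𝕜 E] [NormedAddCommGroup F] [NormedSpace 𝕜 F]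
  [NormedAddCommGroup G] [NormedSpace 𝕜 G]

/-- A translate `a +ᵥ s` of a set of unique differentiability is a set of unique differentiability
(the translation has the identity as derivative). [folklore] -/
private theorem uniqueDiffOn_vadd_set {s : Set F} (hs : UniqueDiffOn 𝕜 s) (a : F) : UniqueDiffOn 𝕜 (a +ᵥ s) := by
  have e : a +ᵥ s = (fun x => a + x) '' s := by
    ext y
    simp only [Set.mem_vadd_set, vadd_eq_add, Set.mem_image]
  rw [e]
  refine hs.image (f' := fun _ => ContinuousLinearMap.id 𝕜 F) (fun x _ => ?_) (fun x _ => ?_)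
  · exact ((hasFDerivAt_id x).const_add a).hasFDerivWithinAt
  · exact Function.surjective_id.denseRange

/-- **Chain rule for an affine substitution within sets, all orders.**  For `f` of class `C^n` within `S`
(`S` of unique differentiability), `A y = a + L y` with `L` continuous linear, the preimage `A⁻¹S` of unique
differentiability and `A y ∈ S`: `D^i_{A⁻¹S}(f ∘ A)(y) = D^i_S f(A y) ∘ (L, …, L)` (`i ≤ n`).  (Translate to
`z ↦ f(a + z)` on `−a +ᵥ S` with `iteratedFDerivWithin_comp_add_left`, then Mathlib's linear chain rule
`ContinuousLinearMap.iteratedFDerivWithin_comp_right`.)  This is the general form of Coleman's §4.5 display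
`f^{(k)}(a)(v₁, …, v_k) = ∂_{t₁}⋯∂_{t_k} f(a + t₁v₁ + ⋯ + t_kv_k)|_{t=0}` (the substitution `t ↦ a + Σ tᵢvᵢ`).
[cite: Coleman2012, §4.5] -/
theorem iteratedFDerivWithin_comp_affine {f : F → G} {S : Set F} {n : WithTop ℕ∞} (hf : ContDiffOn 𝕜 n f S)
    (hS : UniqueDiffOn 𝕜 S) (a : F) (L : E →L[𝕜] F) (hpre : UniqueDiffOn 𝕜 ((fun y => a + L y) ⁻¹' S))
    {y : E} (hy : a + L y ∈ S) {i : ℕ} (hi : (i : WithTop ℕ∞) ≤ n) :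
    iteratedFDerivWithin 𝕜 i (fun y => f (a + L y)) ((fun y => a + L y) ⁻¹' S) y
      = (iteratedFDerivWithin 𝕜 i f S (a + L y)).compContinuousLinearMap fun _ => L := by
  set s₁ : Set F := (-a) +ᵥ S with hs₁
  have hs₁S : a +ᵥ s₁ = S := by rw [hs₁, vadd_neg_vadd]
  have hmem : ∀ z, z ∈ s₁ ↔ a + z ∈ S := by
    intro z
    rw [hs₁, Set.mem_vadd_set_iff_neg_vadd_mem, neg_neg, vadd_eq_add]
  have hg : ContDiffOn 𝕜 n (fun z => f (a + z)) s₁ :=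
    hf.comp (contDiff_const.add contDiff_id).contDiffOn fun z hz => (hmem z).1 hz
  have hs₁u : UniqueDiffOn 𝕜 s₁ := uniqueDiffOn_vadd_set hS (-a)
  have hpre' : L ⁻¹' s₁ = (fun y => a + L y) ⁻¹' S := by
    ext z
    simp only [Set.mem_preimage, hmem]
  have hLy : L y ∈ s₁ := (hmem _).2 hy
  have key := L.iteratedFDerivWithin_comp_right hg hs₁u (by rw [hpre']; exact hpre) hLy hi
  rw [hpre'] at key
  have hfun : ((fun z => f (a + z)) ∘ L) = fun y => f (a + L y) := rfl
  rw [hfun] at key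
  rw [key, iteratedFDerivWithin_comp_add_left, hs₁S]

end Affine

/-! ## §3 Slices of a function `C^n` within `univ ×ˢ I` -/

section Slices

variable {F₁ F₂ G : Type*} [NormedAddCommGroup F₁] [NormedSpace 𝕜 F₁] [NormedAddCommGroup F₂] [NormedSpace 𝕜 F₂]
  [NormedAddCommGroup G] [NormedSpace 𝕜 G]

/-- **Slice in the constrained variable**: for `Φ` of class `C^n` within `univ ×ˢ I` (`I` of unique
differentiability), `e : F₁`, `t ∈ I`, `i ≤ n`:
`D^i_I[Φ(e, ·)](t) = D^i_{univ×I}Φ(e, t) ∘ (inr, …, inr)` — the partial derivatives in the second variable are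
the joint derivative on vectors `(0, h)`. [cite: Coleman2012, §4.5] -/
theorem iteratedFDerivWithin_slice_snd {Φ : F₁ × F₂ → G} {I : Set F₂} {n : WithTop ℕ∞}
    (hΦ : ContDiffOn 𝕜 n Φ (univ ×ˢ I)) (hI : UniqueDiffOn 𝕜 I) (e : F₁) {i : ℕ} (hi : (i : WithTop ℕ∞) ≤ n)
    {t : F₂} (ht : t ∈ I) :
    iteratedFDerivWithin 𝕜 i (fun s => Φ (e, s)) I t
      = (iteratedFDerivWithin 𝕜 i Φ (univ ×ˢ I) (e, t)).compContinuousLinearMap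
          fun _ => ContinuousLinearMap.inr 𝕜 F₁ F₂ := by
  have hA : (fun s : F₂ => ((e, (0 : F₂)) : F₁ × F₂) + (ContinuousLinearMap.inr 𝕜 F₁ F₂) s) = fun s => (e, s) := by
    funext s
    rw [ContinuousLinearMap.inr_apply, Prod.mk_add_mk, add_zero, zero_add]
  have hpre : (fun s : F₂ => ((e, (0 : F₂)) : F₁ × F₂) + (ContinuousLinearMap.inr 𝕜 F₁ F₂) s) ⁻¹' (univ ×ˢ I)
      = I := by
    rw [hA]; ext s; simp
  have hpt : ((e, (0 : F₂)) : F₁ × F₂) + (ContinuousLinearMap.inr 𝕜 F₁ F₂) t = (e, t) := by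
    rw [ContinuousLinearMap.inr_apply, Prod.mk_add_mk, add_zero, zero_add]
  have key := iteratedFDerivWithin_comp_affine hΦ (uniqueDiffOn_univ.prod hI) (e, (0 : F₂))
    (ContinuousLinearMap.inr 𝕜 F₁ F₂) (by rw [hpre]; exact hI) (y := t)
    (by rw [hpt]; exact ⟨mem_univ e, ht⟩) hi
  rw [hpre, hpt] at key
  have hfun : (fun s : F₂ => Φ (((e, (0 : F₂)) : F₁ × F₂) + (ContinuousLinearMap.inr 𝕜 F₁ F₂) s))
      = fun s => Φ (e, s) := by
    funext s
    rw [ContinuousLinearMap.inr_apply, Prod.mk_add_mk, add_zero, zero_add]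
  rw [hfun] at key
  exact key

/-- **Scalar second variable**: `∂^i_{s,I}[Φ(e, ·)](t) = D^i_{univ×I}Φ(e, t)((0,1), …, (0,1))`
(`Φ : F₁ × 𝕜 → G` of class `C^n` within `univ ×ˢ I`, `t ∈ I`, `i ≤ n`). [cite: Coleman2012, §4.5] -/
theorem iteratedDerivWithin_slice_snd_apply {Φ : F₁ × 𝕜 → G} {I : Set 𝕜} {n : WithTop ℕ∞}
    (hΦ : ContDiffOn 𝕜 n Φ (univ ×ˢ I)) (hI : UniqueDiffOn 𝕜 I) (e : F₁) {i : ℕ} (hi : (i : WithTop ℕ∞) ≤ n)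
    {t : 𝕜} (ht : t ∈ I) :
    iteratedDerivWithin i (fun s => Φ (e, s)) I t
      = iteratedFDerivWithin 𝕜 i Φ (univ ×ˢ I) (e, t) fun _ => ((0 : F₁), (1 : 𝕜)) := by
  rw [iteratedDerivWithin_eq_iteratedFDerivWithin, iteratedFDerivWithin_slice_snd hΦ hI e hi ht,
    ContinuousMultilinearMap.compContinuousLinearMap_apply]
  congr 1

/-- **Slice in the free variable**: for `Φ` of class `C^n` within `univ ×ˢ I`, `t ∈ I`, `i ≤ n`:
`D^i[Φ(·, t)](e) = D^i_{univ×I}Φ(e, t) ∘ (inl, …, inl)` (the slice is `C^n` on the whole space; its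
derivatives are the joint within-derivatives on vectors `(h, 0)`). [cite: Coleman2012, §4.5] -/
theorem iteratedFDeriv_slice_fst {Φ : F₁ × F₂ → G} {I : Set F₂} {n : WithTop ℕ∞}
    (hΦ : ContDiffOn 𝕜 n Φ (univ ×ˢ I)) (hI : UniqueDiffOn 𝕜 I) (e : F₁) {i : ℕ} (hi : (i : WithTop ℕ∞) ≤ n)
    {t : F₂} (ht : t ∈ I) :
    iteratedFDeriv 𝕜 i (fun u => Φ (u, t)) e
      = (iteratedFDerivWithin 𝕜 i Φ (univ ×ˢ I) (e, t)).compContinuousLinearMap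
          fun _ => ContinuousLinearMap.inl 𝕜 F₁ F₂ := by
  have hA : (fun u : F₁ => (((0 : F₁), t) : F₁ × F₂) + (ContinuousLinearMap.inl 𝕜 F₁ F₂) u) = fun u => (u, t) := by
    funext u
    rw [ContinuousLinearMap.inl_apply, Prod.mk_add_mk, add_zero, zero_add]
  have hpre : (fun u : F₁ => (((0 : F₁), t) : F₁ × F₂) + (ContinuousLinearMap.inl 𝕜 F₁ F₂) u) ⁻¹' (univ ×ˢ I)
      = univ := by
    rw [hA]; ext u; simp [ht]
  have hpt : (((0 : F₁), t) : F₁ × F₂) + (ContinuousLinearMap.inl 𝕜 F₁ F₂) e = (e, t) := by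
    rw [ContinuousLinearMap.inl_apply, Prod.mk_add_mk, add_zero, zero_add]
  have key := iteratedFDerivWithin_comp_affine hΦ (uniqueDiffOn_univ.prod hI) ((0 : F₁), t)
    (ContinuousLinearMap.inl 𝕜 F₁ F₂) (by rw [hpre]; exact uniqueDiffOn_univ) (y := e)
    (by rw [hpt]; exact ⟨mem_univ e, ht⟩) hi
  rw [hpre, hpt, iteratedFDerivWithin_univ] at key
  have hfun : (fun u : F₁ => Φ ((((0 : F₁), t) : F₁ × F₂) + (ContinuousLinearMap.inl 𝕜 F₁ F₂) u))
      = fun u => Φ (u, t) := by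
    funext u
    rw [ContinuousLinearMap.inl_apply, Prod.mk_add_mk, add_zero, zero_add]
  rw [hfun] at key
  exact key

/-- **Scalar free variable**: `∂^i_u[Φ(·, t)](e) = D^i_{univ×I}Φ(e, t)((1,0), …, (1,0))`
(`Φ : 𝕜 × F₂ → G` of class `C^n` within `univ ×ˢ I`, `t ∈ I`, `i ≤ n`). [cite: Coleman2012, §4.5] -/
theorem iteratedDeriv_slice_fst_apply {Φ : 𝕜 × F₂ → G} {I : Set F₂} {n : WithTop ℕ∞}
    (hΦ : ContDiffOn 𝕜 n Φ (univ ×ˢ I)) (hI : UniqueDiffOn 𝕜 I) (e : 𝕜) {i : ℕ} (hi : (i : WithTop ℕ∞) ≤ n)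
    {t : F₂} (ht : t ∈ I) :
    iteratedDeriv i (fun u => Φ (u, t)) e
      = iteratedFDerivWithin 𝕜 i Φ (univ ×ˢ I) (e, t) fun _ => ((1 : 𝕜), (0 : F₂)) := by
  rw [iteratedDeriv_eq_iteratedFDeriv, iteratedFDeriv_slice_fst hΦ hI e hi ht,
    ContinuousMultilinearMap.compContinuousLinearMap_apply]
  congr 1

/-- The `β`-th within-derivative evaluated on a fixed tuple, `p ↦ D^β_S Φ(p)(w)`, is of class `C^α` within
`S` when `Φ` is of class `C^n` within `S` and `α + β ≤ n`. [folklore] -/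
private theorem contDiffOn_iteratedFDerivWithin_apply_const {E' : Type*} [NormedAddCommGroup E'] [NormedSpace 𝕜 E']
    {Φ : E' → G} {S : Set E'} {n : WithTop ℕ∞} (hΦ : ContDiffOn 𝕜 n Φ S) (hS : UniqueDiffOn 𝕜 S)
    {α β : ℕ} (hαβ : ((α + β : ℕ) : WithTop ℕ∞) ≤ n) (w : Fin β → E') :
    ContDiffOn 𝕜 α (fun p => iteratedFDerivWithin 𝕜 β Φ S p w) S := by
  have hD : ContDiffOn 𝕜 α (iteratedFDerivWithin 𝕜 β Φ S) S :=
    fun p hp => (hΦ p hp).iteratedFDerivWithin_right hS (by exact_mod_cast hαβ) hp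
  exact (ContinuousMultilinearMap.apply 𝕜 (fun _ : Fin β => E') G w).contDiff.comp_contDiffOn hD

end Slices

/-! ## §4 Mixed partial derivatives of `Φ : 𝕜 × 𝕜 → G` within `univ ×ˢ I` -/

section Mixed

variable {𝕂 : Type u} [NontriviallyNormedField 𝕂] {G : Type u} [NormedAddCommGroup G] [NormedSpace 𝕂 G]

/-- **`∂^α_e ∂^β_s Φ(e₀, t) = D^{α+β}Φ(e₀, t)((1,0)^α, (0,1)^β)`**: for `Φ : 𝕜 × 𝕜 → G` of class `C^n` within
`univ ×ˢ I` (`I` of unique differentiability — e.g. a closed interval, for a ONE-SIDED second variable),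
`t ∈ I`, `α + β ≤ n`, the `α`-th derivative in the free variable of the `β`-th derivative within `I` in
the second variable is the entry of the joint within-derivative on `α` copies of `(1,0)` followed by `β`
copies of `(0,1)` (`∂^k f/∂x_{i₁}⋯∂x_{i_k} = f^{(k)}(e_{i₁}, …, e_{i_k})`, Coleman §4.5; `𝕜`, `G` in one
universe). [cite: Coleman2012, §4.5] -/
theorem iteratedDeriv_iteratedDerivWithin_slice_eq_append {Φ : 𝕂 × 𝕂 → G} {I : Set 𝕂} {n : WithTop ℕ∞}
    (hΦ : ContDiffOn 𝕂 n Φ (univ ×ˢ I)) (hI : UniqueDiffOn 𝕂 I) {α β : ℕ}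
    (hαβ : ((α + β : ℕ) : WithTop ℕ∞) ≤ n) (e₀ : 𝕂) {t : 𝕂} (ht : t ∈ I) :
    iteratedDeriv α (fun e => iteratedDerivWithin β (fun s => Φ (e, s)) I t) e₀
      = iteratedFDerivWithin 𝕂 (α + β) Φ (univ ×ˢ I) (e₀, t)
          (Fin.append (fun _ => ((1 : 𝕂), (0 : 𝕂))) (fun _ => ((0 : 𝕂), (1 : 𝕂)))) := by
  have hS : UniqueDiffOn 𝕂 (univ ×ˢ I : Set (𝕂 × 𝕂)) := uniqueDiffOn_univ.prod hI
  have hβ : ((β : ℕ) : WithTop ℕ∞) ≤ n := le_trans (by exact_mod_cast Nat.le_add_left β α) hαβ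
  have h1 : (fun e => iteratedDerivWithin β (fun s => Φ (e, s)) I t)
      = fun e => (fun p : 𝕂 × 𝕂 => iteratedFDerivWithin 𝕂 β Φ (univ ×ˢ I) p
          (fun _ => ((0 : 𝕂), (1 : 𝕂)))) (e, t) := by
    funext e
    exact iteratedDerivWithin_slice_snd_apply hΦ hI e hβ ht
  rw [h1, iteratedDeriv_slice_fst_apply (contDiffOn_iteratedFDerivWithin_apply_const hΦ hS hαβ _) hI e₀
    le_rfl ht]
  exact iteratedFDerivWithin_apply_eq_append hS ⟨mem_univ _, ht⟩ hΦ hαβ _ _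

/-- **`∂^β_s ∂^α_e Φ(e₀, t) = D^{β+α}Φ(e₀, t)((0,1)^β, (1,0)^α)`** — the other order: the `β`-th derivative
within `I` (at `t ∈ I`) of `s ↦ ∂^α_e Φ(e₀, s)` is the entry of the joint within-derivative on `β` copies of
`(0,1)` followed by `α` copies of `(1,0)` (`Φ` of class `C^n` within `univ ×ˢ I`, `α + β ≤ n`; `𝕜`, `G` in
one universe). [cite: Coleman2012, §4.5] -/
theorem iteratedDerivWithin_iteratedDeriv_slice_eq_append {Φ : 𝕂 × 𝕂 → G} {I : Set 𝕂} {n : WithTop ℕ∞}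
    (hΦ : ContDiffOn 𝕂 n Φ (univ ×ˢ I)) (hI : UniqueDiffOn 𝕂 I) {α β : ℕ}
    (hαβ : ((α + β : ℕ) : WithTop ℕ∞) ≤ n) (e₀ : 𝕂) {t : 𝕂} (ht : t ∈ I) :
    iteratedDerivWithin β (fun s => iteratedDeriv α (fun e => Φ (e, s)) e₀) I t
      = iteratedFDerivWithin 𝕂 (β + α) Φ (univ ×ˢ I) (e₀, t)
          (Fin.append (fun _ => ((0 : 𝕂), (1 : 𝕂))) (fun _ => ((1 : 𝕂), (0 : 𝕂)))) := by
  have hS : UniqueDiffOn 𝕂 (univ ×ˢ I : Set (𝕂 × 𝕂)) := uniqueDiffOn_univ.prod hI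
  have hβα : ((β + α : ℕ) : WithTop ℕ∞) ≤ n := by rw [Nat.add_comm]; exact hαβ
  have hα : ((α : ℕ) : WithTop ℕ∞) ≤ n := le_trans (by exact_mod_cast Nat.le_add_right α β) hαβ
  -- on `I` the inner slice is the joint derivative on `(1,0)^α`
  have h1 : Set.EqOn (fun s => iteratedDeriv α (fun e => Φ (e, s)) e₀)
      (fun s => (fun p : 𝕂 × 𝕂 => iteratedFDerivWithin 𝕂 α Φ (univ ×ˢ I) p
          (fun _ => ((1 : 𝕂), (0 : 𝕂)))) (e₀, s)) I :=
    fun s hs => iteratedDeriv_slice_fst_apply hΦ hI e₀ hα hs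
  rw [iteratedDerivWithin_congr h1 ht,
    iteratedDerivWithin_slice_snd_apply (contDiffOn_iteratedFDerivWithin_apply_const hΦ hS hβα _) hI e₀
      le_rfl ht]
  exact iteratedFDerivWithin_apply_eq_append hS ⟨mem_univ _, ht⟩ hΦ hβα _ _

end Mixed

/-! ## §5 Symmetry of the within-derivative at points of the closure of the interior -/

section Symmetry

variable {E F : Type*} [NormedAddCommGroup E] [NormedSpace 𝕜 E] [NormedAddCommGroup F] [NormedSpace 𝕜 F]

/-- **Re-indexing the order**: for `h : m = m'`, `D^{m'}_s f(x)(u) = D^m_s f(x)(u ∘ Fin.cast h)`. [folklore] -/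
private theorem iteratedFDerivWithin_cast_apply {m m' : ℕ} (h : m = m') (f : E → F) (s : Set E) (x : E)
    (u : Fin m' → E) :
    iteratedFDerivWithin 𝕜 m' f s x u = iteratedFDerivWithin 𝕜 m f s x (u ∘ Fin.cast h) := by
  subst h
  rfl

/-- **Swapping the two blocks of a concatenated tuple is a permutation of the slots**:
`Fin.append w v = Fin.append v w ∘ finAddFlip`. [folklore] -/
private theorem append_comp_finAddFlip {X : Type*} {α β : ℕ} (v : Fin α → X) (w : Fin β → X) :
    Fin.append w v = Fin.append v w ∘ (finAddFlip : Fin (β + α) ≃ Fin (α + β)) := by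
  funext i
  refine Fin.addCases (fun k => ?_) (fun k => ?_) i
  · rw [Function.comp_apply, Fin.append_left, finAddFlip_apply_castAdd, Fin.append_right]
  · rw [Function.comp_apply, Fin.append_right, finAddFlip_apply_natAdd, Fin.append_left]

variable [IsRCLikeNormedField 𝕜]

/-- **Symmetry of the higher WITHIN-derivatives (Schwarz) at points of the closure of the interior.**  Over
`ℝ` or `ℂ`: if `f` is of class `C^n` within `s` (a set of unique differentiability), `m ≤ n`, and
`x ∈ s ∩ closure (interior s)`, then `D^m_s f(x)(v ∘ σ) = D^m_s f(x)(v)` for every permutation `σ` of the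
slots.  (At interior points `D^m_s f = D^m f` is symmetric — Coleman §4.4 Cor. 4.3 / the tree's
`iteratedFDeriv_comp_perm_of_le`; `y ↦ D^m_s f(y)` is continuous within `s`, and `x` is a limit of interior
points.)  Covers closed intervals, half-lines, closed convex bodies. [cite: Coleman2012, §4.4 Cor. 4.3] -/
theorem iteratedFDerivWithin_comp_perm_of_mem_closure_interior {f : E → F} {s : Set E} {n : WithTop ℕ∞}
    (hf : ContDiffOn 𝕜 n f s) (hs : UniqueDiffOn 𝕜 s) {m : ℕ} (hm : (m : WithTop ℕ∞) ≤ n) {x : E}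
    (hx : x ∈ s) (hx' : x ∈ closure (interior s)) (v : Fin m → E) (σ : Equiv.Perm (Fin m)) :
    iteratedFDerivWithin 𝕜 m f s x (v ∘ σ) = iteratedFDerivWithin 𝕜 m f s x v := by
  have hcont : ContinuousWithinAt (iteratedFDerivWithin 𝕜 m f s) s x :=
    hf.continuousOn_iteratedFDerivWithin hm hs x hx
  have heq : ∀ y ∈ interior s,
      iteratedFDerivWithin 𝕜 m f s y (v ∘ σ) = iteratedFDerivWithin 𝕜 m f s y v := by
    intro y hy
    have hys : y ∈ s := interior_subset hy
    have hfy : ContDiffAt 𝕜 n f y := (hf y hys).contDiffAt (mem_interior_iff_mem_nhds.1 hy)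
    rw [iteratedFDerivWithin_eq_iteratedFDeriv hs (hfy.of_le hm) hys]
    exact iteratedFDeriv_comp_perm_of_le hfy hm v σ
  haveI hne : (𝓝[interior s] x).NeBot := mem_closure_iff_nhdsWithin_neBot.1 hx'
  have hle : 𝓝[interior s] x ≤ 𝓝[s] x := nhdsWithin_mono x interior_subset
  have hc' : Tendsto (iteratedFDerivWithin 𝕜 m f s) (𝓝[interior s] x) (𝓝 (iteratedFDerivWithin 𝕜 m f s x)) :=
    hcont.tendsto.mono_left hle
  have t1 : Tendsto (fun y => iteratedFDerivWithin 𝕜 m f s y (v ∘ σ)) (𝓝[interior s] x)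
      (𝓝 (iteratedFDerivWithin 𝕜 m f s x (v ∘ σ))) :=
    ((ContinuousMultilinearMap.apply 𝕜 (fun _ : Fin m => E) F (v ∘ σ)).continuous.tendsto _).comp hc'
  have t2 : Tendsto (fun y => iteratedFDerivWithin 𝕜 m f s y v) (𝓝[interior s] x)
      (𝓝 (iteratedFDerivWithin 𝕜 m f s x v)) :=
    ((ContinuousMultilinearMap.apply 𝕜 (fun _ : Fin m => E) F v).continuous.tendsto _).comp hc'
  exact tendsto_nhds_unique_of_eventuallyEq t1 t2 (eventually_nhdsWithin_of_forall heq)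

/-- **The two mixed partials agree: `∂^α_e ∂^β_{s,I} Φ(e₀, t) = ∂^β_{s,I} ∂^α_e Φ(e₀, t)`** for
`Φ : 𝕜 × 𝕜 → G` (`𝕜 = ℝ` or `ℂ`) of class `C^n` within `univ ×ˢ I`, `α + β ≤ n`, at `t ∈ I ∩ closure (interior I)`
(e.g. every point of a nondegenerate closed interval, the endpoint included): both are entries of the
symmetric joint derivative `D^{α+β}_{univ×I}Φ(e₀, t)` (§4), which differ by the block-swap permutation
`finAddFlip` (Schwarz's theorem for all orders, Coleman §4.1 Thm. 4.3, in its within-a-set form; `𝕜`, `G` in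
one universe). [cite: Coleman2012, §4.1 Thm. 4.3] -/
theorem iteratedDeriv_iteratedDerivWithin_comm {𝕂 : Type u} [NontriviallyNormedField 𝕂] [IsRCLikeNormedField 𝕂]
    {G : Type u} [NormedAddCommGroup G] [NormedSpace 𝕂 G] {Φ : 𝕂 × 𝕂 → G} {I : Set 𝕂} {n : WithTop ℕ∞}
    (hΦ : ContDiffOn 𝕂 n Φ (univ ×ˢ I)) (hI : UniqueDiffOn 𝕂 I) {α β : ℕ}
    (hαβ : ((α + β : ℕ) : WithTop ℕ∞) ≤ n) (e₀ : 𝕂) {t : 𝕂} (ht : t ∈ I) (ht' : t ∈ closure (interior I)) :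
    iteratedDeriv α (fun e => iteratedDerivWithin β (fun s => Φ (e, s)) I t) e₀
      = iteratedDerivWithin β (fun s => iteratedDeriv α (fun e => Φ (e, s)) e₀) I t := by
  rw [iteratedDeriv_iteratedDerivWithin_slice_eq_append hΦ hI hαβ e₀ ht,
    iteratedDerivWithin_iteratedDeriv_slice_eq_append hΦ hI hαβ e₀ ht,
    iteratedFDerivWithin_cast_apply (Nat.add_comm α β),
    append_comp_finAddFlip (fun _ : Fin α => ((1 : 𝕂), (0 : 𝕂))) (fun _ : Fin β => ((0 : 𝕂), (1 : 𝕂)))]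
  have hx' : ((e₀, t) : 𝕂 × 𝕂) ∈ closure (interior (univ ×ˢ I : Set (𝕂 × 𝕂))) := by
    rw [interior_prod_eq, interior_univ, closure_prod_eq, closure_univ]
    exact ⟨mem_univ _, ht'⟩
  exact (iteratedFDerivWithin_comp_perm_of_mem_closure_interior hΦ (uniqueDiffOn_univ.prod hI) hαβ
    ⟨mem_univ _, ht⟩ hx' _ ((finCongr (Nat.add_comm α β)).trans finAddFlip)).symm

end Symmetry

/-! ## §6 Product sets `I ×ˢ Λ` (both factors of unique differentiability) and slabs with an OPEN first factor

§3–§5 with `univ ×ˢ I` replaced by a product `I ×ˢ Λ` of two sets of unique differentiability: the FULLY-WITHIN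
forms (suffix `_prod`; e.g. a closed rectangle, corners included — both one-variable derivatives are taken within
their factor), and, for an OPEN first factor `I`, the forms with the unconstrained one-variable derivative
`iteratedDeriv` in the free variable (suffix `_openFst`).  The latter is the parameter set of a function of `(e, λ)`
smooth for `e` in an open interval and `λ` in a one-sided interval — the slab `I ×ˢ [0, δ)` of the
`(e, λ)`-expansion (1.19)–(1.23) of Bałaban's `(Higgs)₂,₃` III, where the running mass `m² + δm²(e, λ)` is positive
only for small `|e|` (consumer `Balaban1983to89/B3Eq119JointSmooth`, whose file-local copies of these lemmas they
replace).  §3–§5 are the case `I = univ` (`uniqueDiffOn_univ`, `isOpen_univ`, `iteratedDerivWithin_univ`).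
Same proofs as §3–§5: the affine chain rule §2 along `s ↦ (e, 0) + inr s` / `u ↦ (0, t) + inl u`, evaluation
on a fixed tuple §1, and the within-symmetry §5 at points of `closure (interior (I ×ˢ Λ)) =
closure (interior I) ×ˢ closure (interior Λ)`. -/

section Prod

variable {F₁ F₂ G : Type*} [NormedAddCommGroup F₁] [NormedSpace 𝕜 F₁] [NormedAddCommGroup F₂] [NormedSpace 𝕜 F₂]
  [NormedAddCommGroup G] [NormedSpace 𝕜 G]

/-- **Slice in the second variable, within a product set**: for `Φ` of class `C^n` within `I ×ˢ Λ` (`I`, `Λ` of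
unique differentiability), `e ∈ I`, `t ∈ Λ`, `i ≤ n`:
`D^i_Λ[Φ(e, ·)](t) = D^i_{I×Λ}Φ(e, t) ∘ (inr, …, inr)`. (folklore, Mathlib-level) [cite: Coleman2012, §4.5] -/
theorem iteratedFDerivWithin_slice_snd_prod {Φ : F₁ × F₂ → G} {I : Set F₁} {Λ : Set F₂} {n : WithTop ℕ∞}
    (hΦ : ContDiffOn 𝕜 n Φ (I ×ˢ Λ)) (hI : UniqueDiffOn 𝕜 I) (hΛ : UniqueDiffOn 𝕜 Λ) {e : F₁} (he : e ∈ I)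
    {i : ℕ} (hi : (i : WithTop ℕ∞) ≤ n) {t : F₂} (ht : t ∈ Λ) :
    iteratedFDerivWithin 𝕜 i (fun s => Φ (e, s)) Λ t
      = (iteratedFDerivWithin 𝕜 i Φ (I ×ˢ Λ) (e, t)).compContinuousLinearMap
          fun _ => ContinuousLinearMap.inr 𝕜 F₁ F₂ := by
  have hA : (fun s : F₂ => ((e, (0 : F₂)) : F₁ × F₂) + (ContinuousLinearMap.inr 𝕜 F₁ F₂) s) = fun s => (e, s) := by
    funext s
    rw [ContinuousLinearMap.inr_apply, Prod.mk_add_mk, add_zero, zero_add]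
  have hpre : (fun s : F₂ => ((e, (0 : F₂)) : F₁ × F₂) + (ContinuousLinearMap.inr 𝕜 F₁ F₂) s) ⁻¹' (I ×ˢ Λ)
      = Λ := by
    rw [hA]; ext s; simp [he]
  have hpt : ((e, (0 : F₂)) : F₁ × F₂) + (ContinuousLinearMap.inr 𝕜 F₁ F₂) t = (e, t) := by
    rw [ContinuousLinearMap.inr_apply, Prod.mk_add_mk, add_zero, zero_add]
  have key := iteratedFDerivWithin_comp_affine hΦ (hI.prod hΛ) (e, (0 : F₂))
    (ContinuousLinearMap.inr 𝕜 F₁ F₂) (by rw [hpre]; exact hΛ) (y := t)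
    (by rw [hpt]; exact ⟨he, ht⟩) hi
  rw [hpre, hpt] at key
  have hfun : (fun s : F₂ => Φ (((e, (0 : F₂)) : F₁ × F₂) + (ContinuousLinearMap.inr 𝕜 F₁ F₂) s))
      = fun s => Φ (e, s) := by
    funext s
    rw [ContinuousLinearMap.inr_apply, Prod.mk_add_mk, add_zero, zero_add]
  rw [hfun] at key
  exact key

/-- **Scalar second variable, within a product set**: `∂^i_{s,Λ}[Φ(e, ·)](t) = D^i_{I×Λ}Φ(e, t)((0,1), …, (0,1))`
(`Φ : F₁ × 𝕜 → G` of class `C^n` within `I ×ˢ Λ`, `I`, `Λ` of unique differentiability, `e ∈ I`, `t ∈ Λ`,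
`i ≤ n`). (folklore, Mathlib-level) [cite: Coleman2012, §4.5] -/
theorem iteratedDerivWithin_slice_snd_apply_prod {Φ : F₁ × 𝕜 → G} {I : Set F₁} {Λ : Set 𝕜} {n : WithTop ℕ∞}
    (hΦ : ContDiffOn 𝕜 n Φ (I ×ˢ Λ)) (hI : UniqueDiffOn 𝕜 I) (hΛ : UniqueDiffOn 𝕜 Λ) {e : F₁} (he : e ∈ I)
    {i : ℕ} (hi : (i : WithTop ℕ∞) ≤ n) {t : 𝕜} (ht : t ∈ Λ) :
    iteratedDerivWithin i (fun s => Φ (e, s)) Λ t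
      = iteratedFDerivWithin 𝕜 i Φ (I ×ˢ Λ) (e, t) fun _ => ((0 : F₁), (1 : 𝕜)) := by
  rw [iteratedDerivWithin_eq_iteratedFDerivWithin, iteratedFDerivWithin_slice_snd_prod hΦ hI hΛ he hi ht,
    ContinuousMultilinearMap.compContinuousLinearMap_apply]
  congr 1

/-- **Slice in the first variable, within a product set**: for `Φ` of class `C^n` within `I ×ˢ Λ` (`I`, `Λ` of
unique differentiability), `e ∈ I`, `t ∈ Λ`, `i ≤ n`:
`D^i_I[Φ(·, t)](e) = D^i_{I×Λ}Φ(e, t) ∘ (inl, …, inl)`. (folklore, Mathlib-level) [cite: Coleman2012, §4.5] -/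
theorem iteratedFDerivWithin_slice_fst_prod {Φ : F₁ × F₂ → G} {I : Set F₁} {Λ : Set F₂} {n : WithTop ℕ∞}
    (hΦ : ContDiffOn 𝕜 n Φ (I ×ˢ Λ)) (hI : UniqueDiffOn 𝕜 I) (hΛ : UniqueDiffOn 𝕜 Λ) {e : F₁} (he : e ∈ I)
    {i : ℕ} (hi : (i : WithTop ℕ∞) ≤ n) {t : F₂} (ht : t ∈ Λ) :
    iteratedFDerivWithin 𝕜 i (fun u => Φ (u, t)) I e
      = (iteratedFDerivWithin 𝕜 i Φ (I ×ˢ Λ) (e, t)).compContinuousLinearMap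
          fun _ => ContinuousLinearMap.inl 𝕜 F₁ F₂ := by
  have hA : (fun u : F₁ => (((0 : F₁), t) : F₁ × F₂) + (ContinuousLinearMap.inl 𝕜 F₁ F₂) u) = fun u => (u, t) := by
    funext u
    rw [ContinuousLinearMap.inl_apply, Prod.mk_add_mk, add_zero, zero_add]
  have hpre : (fun u : F₁ => (((0 : F₁), t) : F₁ × F₂) + (ContinuousLinearMap.inl 𝕜 F₁ F₂) u) ⁻¹' (I ×ˢ Λ)
      = I := by
    rw [hA]; ext u; simp [ht]
  have hpt : (((0 : F₁), t) : F₁ × F₂) + (ContinuousLinearMap.inl 𝕜 F₁ F₂) e = (e, t) := by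
    rw [ContinuousLinearMap.inl_apply, Prod.mk_add_mk, add_zero, zero_add]
  have key := iteratedFDerivWithin_comp_affine hΦ (hI.prod hΛ) ((0 : F₁), t)
    (ContinuousLinearMap.inl 𝕜 F₁ F₂) (by rw [hpre]; exact hI) (y := e)
    (by rw [hpt]; exact ⟨he, ht⟩) hi
  rw [hpre, hpt] at key
  have hfun : (fun u : F₁ => Φ ((((0 : F₁), t) : F₁ × F₂) + (ContinuousLinearMap.inl 𝕜 F₁ F₂) u))
      = fun u => Φ (u, t) := by
    funext u
    rw [ContinuousLinearMap.inl_apply, Prod.mk_add_mk, add_zero, zero_add]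
  rw [hfun] at key
  exact key

/-- **Scalar first variable, within a product set**: `∂^i_{u,I}[Φ(·, t)](e) = D^i_{I×Λ}Φ(e, t)((1,0), …, (1,0))`
(`Φ : 𝕜 × F₂ → G` of class `C^n` within `I ×ˢ Λ`, `I`, `Λ` of unique differentiability, `e ∈ I`, `t ∈ Λ`,
`i ≤ n`). (folklore, Mathlib-level) [cite: Coleman2012, §4.5] -/
theorem iteratedDerivWithin_slice_fst_apply_prod {Φ : 𝕜 × F₂ → G} {I : Set 𝕜} {Λ : Set F₂} {n : WithTop ℕ∞}
    (hΦ : ContDiffOn 𝕜 n Φ (I ×ˢ Λ)) (hI : UniqueDiffOn 𝕜 I) (hΛ : UniqueDiffOn 𝕜 Λ) {e : 𝕜} (he : e ∈ I)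
    {i : ℕ} (hi : (i : WithTop ℕ∞) ≤ n) {t : F₂} (ht : t ∈ Λ) :
    iteratedDerivWithin i (fun u => Φ (u, t)) I e
      = iteratedFDerivWithin 𝕜 i Φ (I ×ˢ Λ) (e, t) fun _ => ((1 : 𝕜), (0 : F₂)) := by
  rw [iteratedDerivWithin_eq_iteratedFDerivWithin, iteratedFDerivWithin_slice_fst_prod hΦ hI hΛ he hi ht,
    ContinuousMultilinearMap.compContinuousLinearMap_apply]
  congr 1

/-- **Scalar first variable, OPEN first factor**: `∂^i_u[Φ(·, t)](e) = D^i_{I×Λ}Φ(e, t)((1,0), …, (1,0))` with the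
unconstrained one-variable derivative (`I` open, so `∂^i_{u,I} = ∂^i_u` on `I`; `Φ : 𝕜 × F₂ → G` of class `C^n`
within `I ×ˢ Λ`, `Λ` of unique differentiability, `e ∈ I`, `t ∈ Λ`, `i ≤ n`). (folklore, Mathlib-level)
[cite: Coleman2012, §4.5] -/
theorem iteratedDeriv_slice_fst_apply_openFst {Φ : 𝕜 × F₂ → G} {I : Set 𝕜} {Λ : Set F₂} {n : WithTop ℕ∞}
    (hΦ : ContDiffOn 𝕜 n Φ (I ×ˢ Λ)) (hI : IsOpen I) (hΛ : UniqueDiffOn 𝕜 Λ) {e : 𝕜} (he : e ∈ I)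
    {i : ℕ} (hi : (i : WithTop ℕ∞) ≤ n) {t : F₂} (ht : t ∈ Λ) :
    iteratedDeriv i (fun u => Φ (u, t)) e
      = iteratedFDerivWithin 𝕜 i Φ (I ×ˢ Λ) (e, t) fun _ => ((1 : 𝕜), (0 : F₂)) := by
  rw [← iteratedDerivWithin_slice_fst_apply_prod hΦ hI.uniqueDiffOn hΛ he hi ht]
  exact (iteratedDerivWithin_of_isOpen hI he).symm

/-- **The slice derivatives in the second variable are smooth in the first, within a product set**:
`e ↦ ∂^β_{s,Λ}[Φ(e, ·)](t)` is of class `C^α` within `I` (`Φ : F₁ × 𝕜 → G` of class `C^n` within `I ×ˢ Λ`, `I`,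
`Λ` of unique differentiability, `t ∈ Λ`, `α + β ≤ n`): on `I` it is `p ↦ D^β_{I×Λ}Φ(p)((0,1)^β)` along
`e ↦ (e, t)`. (folklore, Mathlib-level) [cite: Coleman2012, §4.5] -/
theorem contDiffOn_iteratedDerivWithin_slice_snd_prod {Φ : F₁ × 𝕜 → G} {I : Set F₁} {Λ : Set 𝕜} {n : WithTop ℕ∞}
    (hΦ : ContDiffOn 𝕜 n Φ (I ×ˢ Λ)) (hI : UniqueDiffOn 𝕜 I) (hΛ : UniqueDiffOn 𝕜 Λ) {α β : ℕ}
    (hαβ : ((α + β : ℕ) : WithTop ℕ∞) ≤ n) {t : 𝕜} (ht : t ∈ Λ) :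
    ContDiffOn 𝕜 α (fun e => iteratedDerivWithin β (fun s => Φ (e, s)) Λ t) I := by
  have hS : UniqueDiffOn 𝕜 (I ×ˢ Λ : Set (F₁ × 𝕜)) := hI.prod hΛ
  have hβ : ((β : ℕ) : WithTop ℕ∞) ≤ n := le_trans (by exact_mod_cast Nat.le_add_left β α) hαβ
  have h1 : Set.EqOn (fun e => iteratedDerivWithin β (fun s => Φ (e, s)) Λ t)
      (fun e => (fun p : F₁ × 𝕜 => iteratedFDerivWithin 𝕜 β Φ (I ×ˢ Λ) p
          (fun _ => ((0 : F₁), (1 : 𝕜)))) (e, t)) I :=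
    fun e he => iteratedDerivWithin_slice_snd_apply_prod hΦ hI hΛ he hβ ht
  refine ContDiffOn.congr ?_ h1
  exact (contDiffOn_iteratedFDerivWithin_apply_const hΦ hS hαβ _).comp (contDiffOn_id.prodMk contDiffOn_const)
    fun e he => ⟨he, ht⟩

/-- **The slice derivatives in the first variable are smooth in the second, within a product set**:
`t ↦ ∂^α_{u,I}[Φ(·, t)](e)` is of class `C^β` within `Λ` (`Φ : 𝕜 × F₂ → G` of class `C^n` within `I ×ˢ Λ`, `I`,
`Λ` of unique differentiability, `e ∈ I`, `α + β ≤ n`). (folklore, Mathlib-level) [cite: Coleman2012, §4.5] -/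
theorem contDiffOn_iteratedDerivWithin_slice_fst_prod {Φ : 𝕜 × F₂ → G} {I : Set 𝕜} {Λ : Set F₂} {n : WithTop ℕ∞}
    (hΦ : ContDiffOn 𝕜 n Φ (I ×ˢ Λ)) (hI : UniqueDiffOn 𝕜 I) (hΛ : UniqueDiffOn 𝕜 Λ) {α β : ℕ}
    (hαβ : ((α + β : ℕ) : WithTop ℕ∞) ≤ n) {e : 𝕜} (he : e ∈ I) :
    ContDiffOn 𝕜 β (fun t => iteratedDerivWithin α (fun u => Φ (u, t)) I e) Λ := by
  have hS : UniqueDiffOn 𝕜 (I ×ˢ Λ : Set (𝕜 × F₂)) := hI.prod hΛ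
  have hβα : ((β + α : ℕ) : WithTop ℕ∞) ≤ n := by rw [Nat.add_comm]; exact hαβ
  have hα : ((α : ℕ) : WithTop ℕ∞) ≤ n := le_trans (by exact_mod_cast Nat.le_add_right α β) hαβ
  have h1 : Set.EqOn (fun t => iteratedDerivWithin α (fun u => Φ (u, t)) I e)
      (fun t => (fun p : 𝕜 × F₂ => iteratedFDerivWithin 𝕜 α Φ (I ×ˢ Λ) p
          (fun _ => ((1 : 𝕜), (0 : F₂)))) (e, t)) Λ :=
    fun t ht => iteratedDerivWithin_slice_fst_apply_prod hΦ hI hΛ he hα ht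
  refine ContDiffOn.congr ?_ h1
  exact (contDiffOn_iteratedFDerivWithin_apply_const hΦ hS hβα _).comp (contDiffOn_const.prodMk contDiffOn_id)
    fun t ht => ⟨he, ht⟩

end Prod

section MixedProd

variable {𝕂 : Type u} [NontriviallyNormedField 𝕂] {G : Type u} [NormedAddCommGroup G] [NormedSpace 𝕂 G]

/-- **`∂^α_{u,I} ∂^β_{s,Λ} Φ(e₀, t) = D^{α+β}_{I×Λ}Φ(e₀, t)((1,0)^α, (0,1)^β)`**, fully within: for `Φ : 𝕜 × 𝕜 → G`
of class `C^n` within `I ×ˢ Λ` (`I`, `Λ` of unique differentiability), `e₀ ∈ I`, `t ∈ Λ`, `α + β ≤ n`, the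
`α`-th derivative within `I` of the `β`-th derivative within `Λ` of the slices `Φ(e, ·)` is the entry of the joint
within-derivative on `α` copies of `(1,0)` followed by `β` copies of `(0,1)` (`𝕜`, `G` in one universe).
(folklore, Mathlib-level) [cite: Coleman2012, §4.5] -/
theorem iteratedDerivWithin_iteratedDerivWithin_slice_snd_eq_append_prod {Φ : 𝕂 × 𝕂 → G} {I Λ : Set 𝕂}
    {n : WithTop ℕ∞} (hΦ : ContDiffOn 𝕂 n Φ (I ×ˢ Λ)) (hI : UniqueDiffOn 𝕂 I) (hΛ : UniqueDiffOn 𝕂 Λ)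
    {α β : ℕ} (hαβ : ((α + β : ℕ) : WithTop ℕ∞) ≤ n) {e₀ : 𝕂} (he₀ : e₀ ∈ I) {t : 𝕂} (ht : t ∈ Λ) :
    iteratedDerivWithin α (fun e => iteratedDerivWithin β (fun s => Φ (e, s)) Λ t) I e₀
      = iteratedFDerivWithin 𝕂 (α + β) Φ (I ×ˢ Λ) (e₀, t)
          (Fin.append (fun _ => ((1 : 𝕂), (0 : 𝕂))) (fun _ => ((0 : 𝕂), (1 : 𝕂)))) := by
  have hS : UniqueDiffOn 𝕂 (I ×ˢ Λ : Set (𝕂 × 𝕂)) := hI.prod hΛ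
  have hβ : ((β : ℕ) : WithTop ℕ∞) ≤ n := le_trans (by exact_mod_cast Nat.le_add_left β α) hαβ
  have h1 : Set.EqOn (fun e => iteratedDerivWithin β (fun s => Φ (e, s)) Λ t)
      (fun e => (fun p : 𝕂 × 𝕂 => iteratedFDerivWithin 𝕂 β Φ (I ×ˢ Λ) p
          (fun _ => ((0 : 𝕂), (1 : 𝕂)))) (e, t)) I :=
    fun e he => iteratedDerivWithin_slice_snd_apply_prod hΦ hI hΛ he hβ ht
  rw [iteratedDerivWithin_congr h1 he₀,
    iteratedDerivWithin_slice_fst_apply_prod (contDiffOn_iteratedFDerivWithin_apply_const hΦ hS hαβ _) hI hΛ he₀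
      le_rfl ht]
  exact iteratedFDerivWithin_apply_eq_append hS ⟨he₀, ht⟩ hΦ hαβ _ _

/-- **`∂^β_{s,Λ} ∂^α_{u,I} Φ(e₀, t) = D^{β+α}_{I×Λ}Φ(e₀, t)((0,1)^β, (1,0)^α)`** — the other order, fully within:
the `β`-th derivative within `Λ` (at `t ∈ Λ`) of `s ↦ ∂^α_{u,I}[Φ(·, s)](e₀)` is the entry of the joint
within-derivative on `β` copies of `(0,1)` followed by `α` copies of `(1,0)` (`Φ` of class `C^n` within `I ×ˢ Λ`,
`I`, `Λ` of unique differentiability, `e₀ ∈ I`, `α + β ≤ n`; `𝕜`, `G` in one universe). (folklore, Mathlib-level)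
[cite: Coleman2012, §4.5] -/
theorem iteratedDerivWithin_iteratedDerivWithin_slice_fst_eq_append_prod {Φ : 𝕂 × 𝕂 → G} {I Λ : Set 𝕂}
    {n : WithTop ℕ∞} (hΦ : ContDiffOn 𝕂 n Φ (I ×ˢ Λ)) (hI : UniqueDiffOn 𝕂 I) (hΛ : UniqueDiffOn 𝕂 Λ)
    {α β : ℕ} (hαβ : ((α + β : ℕ) : WithTop ℕ∞) ≤ n) {e₀ : 𝕂} (he₀ : e₀ ∈ I) {t : 𝕂} (ht : t ∈ Λ) :
    iteratedDerivWithin β (fun s => iteratedDerivWithin α (fun e => Φ (e, s)) I e₀) Λ t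
      = iteratedFDerivWithin 𝕂 (β + α) Φ (I ×ˢ Λ) (e₀, t)
          (Fin.append (fun _ => ((0 : 𝕂), (1 : 𝕂))) (fun _ => ((1 : 𝕂), (0 : 𝕂)))) := by
  have hS : UniqueDiffOn 𝕂 (I ×ˢ Λ : Set (𝕂 × 𝕂)) := hI.prod hΛ
  have hβα : ((β + α : ℕ) : WithTop ℕ∞) ≤ n := by rw [Nat.add_comm]; exact hαβ
  have hα : ((α : ℕ) : WithTop ℕ∞) ≤ n := le_trans (by exact_mod_cast Nat.le_add_right α β) hαβ
  have h1 : Set.EqOn (fun s => iteratedDerivWithin α (fun e => Φ (e, s)) I e₀)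
      (fun s => (fun p : 𝕂 × 𝕂 => iteratedFDerivWithin 𝕂 α Φ (I ×ˢ Λ) p
          (fun _ => ((1 : 𝕂), (0 : 𝕂)))) (e₀, s)) Λ :=
    fun s hs => iteratedDerivWithin_slice_fst_apply_prod hΦ hI hΛ he₀ hα hs
  rw [iteratedDerivWithin_congr h1 ht,
    iteratedDerivWithin_slice_snd_apply_prod (contDiffOn_iteratedFDerivWithin_apply_const hΦ hS hβα _) hI hΛ he₀
      le_rfl ht]
  exact iteratedFDerivWithin_apply_eq_append hS ⟨he₀, ht⟩ hΦ hβα _ _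

/-- **`∂^α_e ∂^β_{s,Λ} Φ(e₀, t) = D^{α+β}_{I×Λ}Φ(e₀, t)((1,0)^α, (0,1)^β)`** for an OPEN first factor: `Φ : 𝕜 × 𝕜 → G`
of class `C^n` within `I ×ˢ Λ`, `I` open, `Λ` of unique differentiability, `e₀ ∈ I`, `t ∈ Λ`, `α + β ≤ n`; the
outer derivative is the unconstrained one (`𝕜`, `G` in one universe). (folklore, Mathlib-level)
[cite: Coleman2012, §4.5] -/
theorem iteratedDeriv_iteratedDerivWithin_slice_eq_append_openFst {Φ : 𝕂 × 𝕂 → G} {I Λ : Set 𝕂}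
    {n : WithTop ℕ∞} (hΦ : ContDiffOn 𝕂 n Φ (I ×ˢ Λ)) (hI : IsOpen I) (hΛ : UniqueDiffOn 𝕂 Λ)
    {α β : ℕ} (hαβ : ((α + β : ℕ) : WithTop ℕ∞) ≤ n) {e₀ : 𝕂} (he₀ : e₀ ∈ I) {t : 𝕂} (ht : t ∈ Λ) :
    iteratedDeriv α (fun e => iteratedDerivWithin β (fun s => Φ (e, s)) Λ t) e₀
      = iteratedFDerivWithin 𝕂 (α + β) Φ (I ×ˢ Λ) (e₀, t)
          (Fin.append (fun _ => ((1 : 𝕂), (0 : 𝕂))) (fun _ => ((0 : 𝕂), (1 : 𝕂)))) := by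
  rw [← iteratedDerivWithin_iteratedDerivWithin_slice_snd_eq_append_prod hΦ hI.uniqueDiffOn hΛ hαβ he₀ ht]
  exact (iteratedDerivWithin_of_isOpen hI he₀).symm

/-- **`∂^β_{s,Λ} ∂^α_e Φ(e₀, t) = D^{β+α}_{I×Λ}Φ(e₀, t)((0,1)^β, (1,0)^α)`** for an OPEN first factor — the other
order: the `β`-th derivative within `Λ` of `s ↦ ∂^α_e[Φ(·, s)](e₀)` (unconstrained inner derivative; `I` open
`∋ e₀`, `Λ` of unique differentiability `∋ t`, `Φ` of class `C^n` within `I ×ˢ Λ`, `α + β ≤ n`; `𝕜`, `G` in one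
universe). (folklore, Mathlib-level) [cite: Coleman2012, §4.5] -/
theorem iteratedDerivWithin_iteratedDeriv_slice_eq_append_openFst {Φ : 𝕂 × 𝕂 → G} {I Λ : Set 𝕂}
    {n : WithTop ℕ∞} (hΦ : ContDiffOn 𝕂 n Φ (I ×ˢ Λ)) (hI : IsOpen I) (hΛ : UniqueDiffOn 𝕂 Λ)
    {α β : ℕ} (hαβ : ((α + β : ℕ) : WithTop ℕ∞) ≤ n) {e₀ : 𝕂} (he₀ : e₀ ∈ I) {t : 𝕂} (ht : t ∈ Λ) :
    iteratedDerivWithin β (fun s => iteratedDeriv α (fun e => Φ (e, s)) e₀) Λ t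
      = iteratedFDerivWithin 𝕂 (β + α) Φ (I ×ˢ Λ) (e₀, t)
          (Fin.append (fun _ => ((0 : 𝕂), (1 : 𝕂))) (fun _ => ((1 : 𝕂), (0 : 𝕂)))) := by
  have h : (fun s => iteratedDeriv α (fun e => Φ (e, s)) e₀)
      = fun s => iteratedDerivWithin α (fun e => Φ (e, s)) I e₀ := by
    funext s
    exact (iteratedDerivWithin_of_isOpen hI he₀).symm
  rw [h]
  exact iteratedDerivWithin_iteratedDerivWithin_slice_fst_eq_append_prod hΦ hI.uniqueDiffOn hΛ hαβ he₀ ht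

/-- **The one-sided slice derivatives are smooth in the free variable** (open first factor):
`e ↦ ∂^β_{s,Λ}[Φ(e, ·)](t)` is of class `C^α` on the open set `I` (`Φ : 𝕜 × 𝕜 → G` of class `C^n` within
`I ×ˢ Λ`, `Λ` of unique differentiability `∋ t`, `α + β ≤ n`). (folklore, Mathlib-level) [cite: Coleman2012, §4.5] -/
theorem contDiffOn_iteratedDerivWithin_slice_openFst {Φ : 𝕂 × 𝕂 → G} {I Λ : Set 𝕂} {n : WithTop ℕ∞}
    (hΦ : ContDiffOn 𝕂 n Φ (I ×ˢ Λ)) (hI : IsOpen I) (hΛ : UniqueDiffOn 𝕂 Λ) {α β : ℕ}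
    (hαβ : ((α + β : ℕ) : WithTop ℕ∞) ≤ n) {t : 𝕂} (ht : t ∈ Λ) :
    ContDiffOn 𝕂 α (fun e => iteratedDerivWithin β (fun s => Φ (e, s)) Λ t) I :=
  contDiffOn_iteratedDerivWithin_slice_snd_prod hΦ hI.uniqueDiffOn hΛ hαβ ht

end MixedProd

section SymmetryProd

variable {𝕂 : Type u} [NontriviallyNormedField 𝕂] [IsRCLikeNormedField 𝕂] {G : Type u} [NormedAddCommGroup G]
  [NormedSpace 𝕂 G]

/-- **The two mixed partials agree, fully within a product set:
`∂^α_{u,I} ∂^β_{s,Λ} Φ(e₀, t) = ∂^β_{s,Λ} ∂^α_{u,I} Φ(e₀, t)`** for `Φ : 𝕜 × 𝕜 → G` (`𝕜 = ℝ` or `ℂ`) of class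
`C^n` within `I ×ˢ Λ` (`I`, `Λ` of unique differentiability), `α + β ≤ n`, at `e₀ ∈ I ∩ closure (interior I)`,
`t ∈ Λ ∩ closure (interior Λ)` (e.g. every point of a closed rectangle with nonempty interior, corners included):
both are entries of the joint derivative `D^{α+β}_{I×Λ}Φ(e₀, t)`, symmetric at points of
`closure (interior (I ×ˢ Λ))` (§5), and differ by the block swap `finAddFlip` (Schwarz for all orders, Coleman
§4.1 Thm. 4.3, within a product set; `𝕜`, `G` in one universe). (folklore, Mathlib-level)
[cite: Coleman2012, §4.1 Thm. 4.3] -/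
theorem iteratedDerivWithin_iteratedDerivWithin_comm_prod {Φ : 𝕂 × 𝕂 → G} {I Λ : Set 𝕂} {n : WithTop ℕ∞}
    (hΦ : ContDiffOn 𝕂 n Φ (I ×ˢ Λ)) (hI : UniqueDiffOn 𝕂 I) (hΛ : UniqueDiffOn 𝕂 Λ) {α β : ℕ}
    (hαβ : ((α + β : ℕ) : WithTop ℕ∞) ≤ n) {e₀ : 𝕂} (he₀ : e₀ ∈ I) (he₀' : e₀ ∈ closure (interior I))
    {t : 𝕂} (ht : t ∈ Λ) (ht' : t ∈ closure (interior Λ)) :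
    iteratedDerivWithin α (fun e => iteratedDerivWithin β (fun s => Φ (e, s)) Λ t) I e₀
      = iteratedDerivWithin β (fun s => iteratedDerivWithin α (fun e => Φ (e, s)) I e₀) Λ t := by
  rw [iteratedDerivWithin_iteratedDerivWithin_slice_snd_eq_append_prod hΦ hI hΛ hαβ he₀ ht,
    iteratedDerivWithin_iteratedDerivWithin_slice_fst_eq_append_prod hΦ hI hΛ hαβ he₀ ht,
    iteratedFDerivWithin_cast_apply (Nat.add_comm α β),
    append_comp_finAddFlip (fun _ : Fin α => ((1 : 𝕂), (0 : 𝕂))) (fun _ : Fin β => ((0 : 𝕂), (1 : 𝕂)))]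
  have hx' : ((e₀, t) : 𝕂 × 𝕂) ∈ closure (interior (I ×ˢ Λ : Set (𝕂 × 𝕂))) := by
    rw [interior_prod_eq, closure_prod_eq]
    exact ⟨he₀', ht'⟩
  exact (iteratedFDerivWithin_comp_perm_of_mem_closure_interior hΦ (hI.prod hΛ) hαβ
    ⟨he₀, ht⟩ hx' _ ((finCongr (Nat.add_comm α β)).trans finAddFlip)).symm

/-- **The two mixed partials agree, open first factor: `∂^α_e ∂^β_{s,Λ} Φ(e₀, t) = ∂^β_{s,Λ} ∂^α_e Φ(e₀, t)`**
for `Φ : 𝕜 × 𝕜 → G` (`𝕜 = ℝ` or `ℂ`) of class `C^n` within `I ×ˢ Λ`, `I` open `∋ e₀`, `Λ` of unique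
differentiability, `α + β ≤ n`, at `t ∈ Λ ∩ closure (interior Λ)` (e.g. the endpoint `0` of `[0, δ)`: the
one-sided mixed partials at `λ = 0⁺` of a function smooth on the slab `I ×ˢ [0, δ)` commute with the
`e`-derivatives). (folklore, Mathlib-level) [cite: Coleman2012, §4.1 Thm. 4.3] -/
theorem iteratedDeriv_iteratedDerivWithin_comm_openFst {Φ : 𝕂 × 𝕂 → G} {I Λ : Set 𝕂} {n : WithTop ℕ∞}
    (hΦ : ContDiffOn 𝕂 n Φ (I ×ˢ Λ)) (hI : IsOpen I) (hΛ : UniqueDiffOn 𝕂 Λ) {α β : ℕ}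
    (hαβ : ((α + β : ℕ) : WithTop ℕ∞) ≤ n) {e₀ : 𝕂} (he₀ : e₀ ∈ I) {t : 𝕂} (ht : t ∈ Λ)
    (ht' : t ∈ closure (interior Λ)) :
    iteratedDeriv α (fun e => iteratedDerivWithin β (fun s => Φ (e, s)) Λ t) e₀
      = iteratedDerivWithin β (fun s => iteratedDeriv α (fun e => Φ (e, s)) e₀) Λ t := by
  have h : (fun s => iteratedDeriv α (fun e => Φ (e, s)) e₀)
      = fun s => iteratedDerivWithin α (fun e => Φ (e, s)) I e₀ := by
    funext s
    exact (iteratedDerivWithin_of_isOpen hI he₀).symm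
  have h' : iteratedDeriv α (fun e => iteratedDerivWithin β (fun s => Φ (e, s)) Λ t) e₀
      = iteratedDerivWithin α (fun e => iteratedDerivWithin β (fun s => Φ (e, s)) Λ t) I e₀ :=
    (iteratedDerivWithin_of_isOpen hI he₀).symm
  rw [h, h']
  have he₀' : e₀ ∈ closure (interior I) := by
    rw [hI.interior_eq]
    exact subset_closure he₀
  exact iteratedDerivWithin_iteratedDerivWithin_comm_prod hΦ hI.uniqueDiffOn hΛ hαβ he₀ he₀' ht ht'

end SymmetryProd

end Literature.Analysis.Calculus

end
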